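import Summits.ResolutionOfSingularities.ResolutionOfSingularities.Theorems.PurelyInseparableDim4ResConeLossyTiltFreeStep
import Summits.ResolutionOfSingularities.ResolutionOfSingularities.Theorems.PurelyInseparableDim4ResConeLossFreeTail
import HarnessLib
import HarnessLib.Audit.Tags

/-!
# Purely inseparable four-folds — NO LOSSY TILT-FREE D∞ TAIL at `(p, d) = (5, 4)`: the END GAME and the headline
# of the tilt-free D∞ brick (K2(p) lane, SLICE C, FILE 2b; file-holder res-dim4-p-5 g4)

[OURS · counted 0 · cell `res-dim4-pi` · K2(p) lane, slice C (desk WORDS #128 (h), #130 (b)) · seat p-5 g4.]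
Nothing here proves K2(p)/K2(5), `NoIsolatedTrap p p` or resolution of singularities in dimension ≥ 4 / char. `p`.

Setting of `…LossyTiltFreeStep` plus LOSSY (a boundary letter is translated beyond every index).  idea-4 E2 §D END
GAME in the tree's frame:
* **`false_of_seed44`** — from a `(2,1)`-state carrying `x_a⁴x_{a′}⁴` no step is possible: `T_a` puts `x_a³x_{a′}⁴` into
  the degree-`7` row against tilt-freeness, a lose-both in either orientation contradicts (D1), keeping `a` in chart
  `a′` gives the two-layer `(2,2)` child (not isolated);
* **`corner_of_seed45`** — from a `(2,1)`-state carrying `x_a⁴x_{a′}⁵` the step is the pure corner `T_a` (both lose-both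
  orientations contradict the rigid degree-`9` row, keeping `a` is `(2,2)`), which keeps `(2,1)`, fixes `x_a⁴x_{a′}⁵`
  and its coefficient;
* `false_of_loseBoth` — after a lose-both step the tail is impossible (seed 44: at once; seed 45: all later steps are
  pure corners, so the tail is loss-free, against LOSSY);
* **`no_lossy_tiltFree_pair_tail_four_five`** — no such LOSSY tail exists (the first loss after `k₀` is a lose-both
  step in one of the two orientations);
* **`no_tiltFree_pair_tail_four_five`** — HEADLINE, outright: NO tilt-free passive-free binary-cone tail at `(5, 4)` at all
  (chart letters from `chain_letters_of_tiltFree`; the eventually loss-free case is res-dim4-p-5 g3's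
  `…LossFreeTail.no_lossfree_tail`).
`p = 5 = d + 1` is used through `…LossyTiltFreeLegality` (Frobenius sextic row; numerology `j ≥ 4n − 2D + 1`).
NOT claimed: tilted D∞ tails (res-dim4-idea-4 g4's (PC) Hasse-contact dictionary would reduce them to FILE 1), a
passive BOUNDARY letter (B∞), other `(p, d)`; K2(5) stays OPEN.
[cite: CossartJannsenSaito2020, Thm. 3.14, Lemma 13.2, Thm. 13.7] [cite: HauserPerlega2019PRIMS, §2 (transform D′ of D)]
bears_on: LADDER-RESOLUTION:D157-DOOR2 (res-dim4-pi · K2(p) = `RidgeBudget.NoAboveFloorTrap p p` · slice C, lossy residual,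
D∞ tilt-free).  Supports stmt-ResolutionOfSingularities-16155 (helper).
-/

set_option linter.dupNamespace false -- mandated namespace of this single-conjunct summit

noncomputable section

namespace Summit.ResolutionOfSingularities.ResolutionOfSingularities.Theorems.PIDim4

namespace ResCone

open MvPolynomial Finset
open Literature.AlgebraicGeometry.Resolution
open Literature.AlgebraicGeometry.Resolution.CentreBlowup
open Literature.AlgebraicGeometry.Resolution.Hauser2010
open Literature.AlgebraicGeometry.Resolution.HauserPerlega2019
open PointBlowup (direction)

variable {K : Type} [Field K] [CharP K 5] [DecidableEq K]

section EndGame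

/-- **END GAME, SEED `x_a⁴x_{a′}⁴`: NO STEP IS POSSIBLE** from a `(2,1)`-state of the tilt-free tail carrying
`x_a⁴x_{a′}⁴` (idea-4 E2 §D, case «x″²ỹ″³ present»): the pure corner `T_a` puts `x_a³x_{a′}⁴` into the degree-`7` row
(not inert: tilt-freeness fails), a lose-both in either orientation contradicts (D1) (degree-`8` inert-free
coefficients vanish), keeping `a` in the chart `a′` produces the two-layer child `x_a²x_{a′}²` (not isolated). [OURS]
[cite: CossartJannsenSaito2020, Lemma 13.2, Thm. 13.7] -/
theorem false_of_seed44 {c : ℕ → State K} {j : ℕ → Fin 4} {b : ℕ → Fin 4 → K}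
    (hc : ∀ k, IsIsolated 5 (c k).F ∧ Step0 5 (c k) (c (k + 1))) (hw : FreeTail.IsWitnessedChain 5 c j b)
    (hr0 : ∀ e ∈ (c 0).F.support, (c 0).r ≤ e) (hfloor : ∀ k, ordZero (c k).F ≠ 5) {k₀ : ℕ}
    (hshade : ∀ k, k₀ ≤ k → (c k).shade = ((4 : ℕ) : ℕ∞))
    (he : ∀ k, k₀ ≤ k → Module.finrank K (resVertex (c k)) = 2) {a a' : Fin 4} (haa : a ≠ a')
    (hletters : ∀ k, k₀ ≤ k → (j k = a ∨ j k = a'))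
    (htilt : ∀ k, k₀ ≤ k → (Pi.single a 1 : Fin 4 → K) ∈ resVertex (c k) ∧
      (Pi.single a' 1 : Fin 4 → K) ∈ resVertex (c k))
    (hpass : ∀ k, k₀ ≤ k → ∀ i, i ≠ a → i ≠ a' → (c k).r i = 0)
    {m : ℕ} (hm : k₀ ≤ m) (hrm : (c m).r = Finsupp.single a 2 + Finsupp.single a' 1)
    (h44 : coeff (Finsupp.single a 4 + Finsupp.single a' 4) (c m).F ≠ 0) : False := by
  haveI : Fact (Nat.Prime 5) := ⟨by norm_num⟩
  obtain ⟨o, ho, hosum, -, -, hrk, -⟩ := chain_basics hc hr0 hfloor hshade haa hpass hm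
  have hra : (c m).r a = 2 := by rw [hrm, two_apply haa, if_pos rfl]
  have hra' : (c m).r a' = 1 := by rw [hrm, two_apply haa, if_neg haa.symm, if_pos rfl]
  have ho7 : o = 7 := by omega
  have hdeg44 : (Finsupp.single a 4 + Finsupp.single a' 4 : Fin 4 →₀ ℕ).degree = 8 := by
    rw [map_add, Finsupp.degree_single, Finsupp.degree_single]
  rcases hletters m hm with hja | hja'
  · by_cases htm : b m a' = 0
    · -- the pure corner `T_a`
      have hbm : b m = 0 := by
        funext i
        by_cases hia' : i = a'
        · rw [hia']; exact htm
        · by_cases hia : i = a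
          · rw [hia, ← hja]; exact (hw m).2.1
          · exact chain_translation_passive hc hw hr0 hfloor hshade he haa hletters htilt hm hia hia'
      have hstep : c (m + 1) = CentreBlowup.step 5 Finset.univ a 0 (c m) := by rw [(hw m).2.2.2.2, hja, hbm]
      obtain ⟨o₁, ho₁, ho₁sum, -, -, -, -⟩ := chain_basics hc hr0 hfloor hshade haa hpass (k := m + 1) (by omega)
      have law := step_r_univ 5 a (b := (0 : Fin 4 → K)) rfl (c m) ho hrk
      rw [← hstep] at law
      have hr1a : (c (m + 1)).r a = 2 := by rw [law, Finsupp.coe_update, Function.update_self]; omega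
      have hr1a' : (c (m + 1)).r a' = 1 := by
        rw [law, Finsupp.coe_update, Function.update_of_ne haa.symm, Finsupp.filter_apply,
          if_pos (show (0 : Fin 4 → K) a' = 0 from rfl), hra']
      have ho₁7 : o₁ = 7 := by omega
      have hcoeff : coeff (Finsupp.single a 3 + Finsupp.single a' 4) (c (m + 1)).F =
          coeff (Finsupp.single a 4 + Finsupp.single a' 4) (c m).F := by
        rw [hstep, ← chartExponent_two_left haa 4 4 3 rfl,
          coeff_step_F_chartExponent 5 a rfl (c m) (hw m).1 (by rw [hdeg44]; omega),
          chartExponent_two_left haa 4 4 3 rfl, if_neg, shear_zero]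
        exact not_isPthPowerExponent_of_not_dvd (i := a) (by rw [two_apply haa, if_pos rfl]; omega)
      have hmem : Finsupp.single a 3 + Finsupp.single a' 4 ∈ (c (m + 1)).F.support := by
        rw [MvPolynomial.mem_support_iff, hcoeff]; exact h44
      obtain ⟨-, -, h7eq⟩ := chain_tiltFree_row hc hr0 hshade htilt (k := m + 1) (by omega) ho₁ hmem
      have h := (h7eq (by rw [map_add, Finsupp.degree_single, Finsupp.degree_single, ho₁7])).1
      rw [two_apply haa, if_pos rfl, hr1a] at h
      omega
    · -- lose-both `(a, a′)`
      obtain ⟨-, -, h8, -, -⟩ := loseBoth_package hc hw hr0 hfloor hshade he haa hletters htilt hpass hm hja htm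
      exact h44 (h8 _ hdeg44 (by rw [degIn_passive_pair]; omega))
  · by_cases htm : b m a = 0
    · -- chart `a′` keeping `a`: the `(2,2)` child is not isolated
      obtain ⟨o₁, -, -, hpair₁, -, -, -⟩ := chain_basics hc hr0 hfloor hshade haa hpass (k := m + 1) (by omega)
      have law := step_r_univ 5 (j m) (hw m).2.1 (c m) ho hrk
      rw [← (hw m).2.2.2.2, hja'] at law
      have h1a' : (c (m + 1)).r a' = o - 5 := by rw [law, Finsupp.coe_update, Function.update_self]
      have h1a : (c (m + 1)).r a = 2 := by
        rw [law, Finsupp.coe_update, Function.update_of_ne haa, Finsupp.filter_apply, if_pos htm, hra]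
      omega
    · -- lose-both `(a′, a)`: the package with the letters swapped
      obtain ⟨-, -, h8, -, -⟩ := loseBoth_package hc hw hr0 hfloor hshade he haa.symm
        (fun k hk => (hletters k hk).symm) (fun k hk => ⟨(htilt k hk).2, (htilt k hk).1⟩)
        (fun k hk i h1 h2 => hpass k hk i h2 h1) hm hja' htm
      refine h44 (h8 _ hdeg44 ?_)
      rw [add_comm, degIn_passive_pair]; omega

/-- **END GAME, SEED `x_a⁴x_{a′}⁵`: EVERY STEP IS THE PURE CORNER `T_a`** from a `(2,1)`-state of the tilt-free tail
carrying `x_a⁴x_{a′}⁵` (idea-4 E2 §D, case «x″²ỹ″⁴ present»): both lose-both orientations contradict the rigid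
degree-`9` row (its inner coefficients vanish), keeping `a` in chart `a′` is the non-isolated `(2,2)` child; the corner
`T_a` keeps the weights `(2,1)`, FIXES the exponent `x_a⁴x_{a′}⁵` and its coefficient. [OURS]
[cite: CossartJannsenSaito2020, Lemma 13.2, Thm. 13.7] -/
theorem corner_of_seed45 {c : ℕ → State K} {j : ℕ → Fin 4} {b : ℕ → Fin 4 → K}
    (hc : ∀ k, IsIsolated 5 (c k).F ∧ Step0 5 (c k) (c (k + 1))) (hw : FreeTail.IsWitnessedChain 5 c j b)
    (hr0 : ∀ e ∈ (c 0).F.support, (c 0).r ≤ e) (hfloor : ∀ k, ordZero (c k).F ≠ 5) {k₀ : ℕ}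
    (hshade : ∀ k, k₀ ≤ k → (c k).shade = ((4 : ℕ) : ℕ∞))
    (he : ∀ k, k₀ ≤ k → Module.finrank K (resVertex (c k)) = 2) {a a' : Fin 4} (haa : a ≠ a')
    (hletters : ∀ k, k₀ ≤ k → (j k = a ∨ j k = a'))
    (htilt : ∀ k, k₀ ≤ k → (Pi.single a 1 : Fin 4 → K) ∈ resVertex (c k) ∧
      (Pi.single a' 1 : Fin 4 → K) ∈ resVertex (c k))
    (hpass : ∀ k, k₀ ≤ k → ∀ i, i ≠ a → i ≠ a' → (c k).r i = 0)
    {m : ℕ} (hm : k₀ ≤ m) (hrm : (c m).r = Finsupp.single a 2 + Finsupp.single a' 1)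
    (h45 : coeff (Finsupp.single a 4 + Finsupp.single a' 5) (c m).F ≠ 0) :
    b m = 0 ∧ (c (m + 1)).r = Finsupp.single a 2 + Finsupp.single a' 1 ∧
      coeff (Finsupp.single a 4 + Finsupp.single a' 5) (c (m + 1)).F ≠ 0 := by
  haveI : Fact (Nat.Prime 5) := ⟨by norm_num⟩
  obtain ⟨o, ho, hosum, -, -, hrk, -⟩ := chain_basics hc hr0 hfloor hshade haa hpass hm
  have hra : (c m).r a = 2 := by rw [hrm, two_apply haa, if_pos rfl]
  have hra' : (c m).r a' = 1 := by rw [hrm, two_apply haa, if_neg haa.symm, if_pos rfl]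
  have ho7 : o = 7 := by omega
  have hdeg45 : (Finsupp.single a 4 + Finsupp.single a' 5 : Fin 4 →₀ ℕ).degree = 9 := by
    rw [map_add, Finsupp.degree_single, Finsupp.degree_single]
  rcases hletters m hm with hja | hja'
  · by_cases htm : b m a' = 0
    · -- the pure corner `T_a`: weights and the marker survive
      have hbm : b m = 0 := by
        funext i
        by_cases hia' : i = a'
        · rw [hia']; exact htm
        · by_cases hia : i = a
          · rw [hia, ← hja]; exact (hw m).2.1
          · exact chain_translation_passive hc hw hr0 hfloor hshade he haa hletters htilt hm hia hia'
      have hstep : c (m + 1) = CentreBlowup.step 5 Finset.univ a 0 (c m) := by rw [(hw m).2.2.2.2, hja, hbm]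
      have law := step_r_univ 5 a (b := (0 : Fin 4 → K)) rfl (c m) ho hrk
      rw [← hstep] at law
      refine ⟨hbm, ?_, ?_⟩
      · ext i
        rw [law, Finsupp.coe_update, hrm, two_apply haa]
        by_cases hia : i = a
        · rw [hia, Function.update_self, if_pos rfl]; omega
        · rw [Function.update_of_ne hia, Finsupp.filter_apply, if_pos (show (0 : Fin 4 → K) i = 0 from rfl),
            two_apply haa, if_neg hia]
      · rw [hstep, ← chartExponent_two_left haa 4 5 4 rfl,
          coeff_step_F_chartExponent 5 a rfl (c m) (hw m).1 (by rw [hdeg45]; omega),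
          chartExponent_two_left haa 4 5 4 rfl, if_neg, shear_zero]
        · exact h45
        · exact not_isPthPowerExponent_of_not_dvd (i := a) (by rw [two_apply haa, if_pos rfl]; omega)
    · -- lose-both `(a, a′)`: inner coefficient `j = 4` of the rigid row
      exfalso
      obtain ⟨-, -, -, h9, -⟩ := loseBoth_package hc hw hr0 hfloor hshade he haa hletters htilt hpass hm hja htm
      have h := h9 4 (by norm_num) le_rfl
      have hexp : (c m).r + (Finsupp.single a (6 - 4) + Finsupp.single a' 4) =
          Finsupp.single a 4 + Finsupp.single a' 5 := by
        ext i
        rw [Finsupp.add_apply, hrm, two_apply haa, two_apply haa, two_apply haa]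
        by_cases hia : i = a
        · rw [if_pos hia, if_pos hia, if_pos hia]
        · rw [if_neg hia, if_neg hia, if_neg hia]
          by_cases hia' : i = a'
          · rw [if_pos hia', if_pos hia', if_pos hia']
          · rw [if_neg hia', if_neg hia', if_neg hia']
      rw [hexp] at h
      exact h45 h
  · exfalso
    by_cases htm : b m a = 0
    · -- chart `a′` keeping `a`: the `(2,2)` child is not isolated
      obtain ⟨o₁, -, -, hpair₁, -, -, -⟩ := chain_basics hc hr0 hfloor hshade haa hpass (k := m + 1) (by omega)
      have law := step_r_univ 5 (j m) (hw m).2.1 (c m) ho hrk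
      rw [← (hw m).2.2.2.2, hja'] at law
      have h1a' : (c (m + 1)).r a' = o - 5 := by rw [law, Finsupp.coe_update, Function.update_self]
      have h1a : (c (m + 1)).r a = 2 := by
        rw [law, Finsupp.coe_update, Function.update_of_ne haa, Finsupp.filter_apply, if_pos htm, hra]
      omega
    · -- lose-both `(a′, a)`: inner coefficient `j = 2` of the rigid row, letters swapped
      obtain ⟨-, -, -, h9, -⟩ := loseBoth_package hc hw hr0 hfloor hshade he haa.symm
        (fun k hk => (hletters k hk).symm) (fun k hk => ⟨(htilt k hk).2, (htilt k hk).1⟩)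
        (fun k hk i h1 h2 => hpass k hk i h2 h1) hm hja' htm
      have h := h9 2 le_rfl (by norm_num)
      have hexp : (c m).r + (Finsupp.single a' (6 - 2) + Finsupp.single a 2) =
          Finsupp.single a 4 + Finsupp.single a' 5 := by
        ext i
        rw [Finsupp.add_apply, hrm, two_apply haa, two_apply haa.symm, two_apply haa]
        by_cases hia : i = a
        · rw [if_pos hia, if_neg (fun h => haa (hia.symm.trans h)), if_pos hia, if_pos hia]
        · rw [if_neg hia, if_neg hia, if_neg hia]
          by_cases hia' : i = a'
          · rw [if_pos hia', if_pos hia', if_pos hia']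
          · rw [if_neg hia', if_neg hia', if_neg hia']
      rw [hexp] at h
      exact h45 h

/-- **AFTER A LOSE-BOTH STEP THE TILT-FREE TAIL IS IMPOSSIBLE** (oriented form: the lose-both is in chart `a`
translating `a′`).  Seed `x_a⁴x_{a′}⁴`: no next step; seed `x_a⁴x_{a′}⁵`: every later step is the pure corner `T_a`,
so no boundary letter is ever translated again — against LOSSY. [OURS] [cite: CossartJannsenSaito2020, Thm. 13.7] -/
theorem false_of_loseBoth {c : ℕ → State K} {j : ℕ → Fin 4} {b : ℕ → Fin 4 → K}
    (hc : ∀ k, IsIsolated 5 (c k).F ∧ Step0 5 (c k) (c (k + 1))) (hw : FreeTail.IsWitnessedChain 5 c j b)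
    (hr0 : ∀ e ∈ (c 0).F.support, (c 0).r ≤ e) (hfloor : ∀ k, ordZero (c k).F ≠ 5) {k₀ : ℕ}
    (hshade : ∀ k, k₀ ≤ k → (c k).shade = ((4 : ℕ) : ℕ∞))
    (he : ∀ k, k₀ ≤ k → Module.finrank K (resVertex (c k)) = 2) {a a' : Fin 4} (haa : a ≠ a')
    (hletters : ∀ k, k₀ ≤ k → (j k = a ∨ j k = a'))
    (htilt : ∀ k, k₀ ≤ k → (Pi.single a 1 : Fin 4 → K) ∈ resVertex (c k) ∧
      (Pi.single a' 1 : Fin 4 → K) ∈ resVertex (c k))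
    (hpass : ∀ k, k₀ ≤ k → ∀ i, i ≠ a → i ≠ a' → (c k).r i = 0)
    (hlossy : ∀ N, ∃ k, N ≤ k ∧ ∃ i, i ≠ j k ∧ b k i ≠ 0 ∧ 1 ≤ (c k).r i)
    {k : ℕ} (hk : k₀ ≤ k) (hjk : j k = a) (ht : b k a' ≠ 0) : False := by
  obtain ⟨-, hr2, -, -, hseed⟩ := loseBoth_package hc hw hr0 hfloor hshade he haa hletters htilt hpass hk hjk ht
  rcases hseed with h44 | h45
  · exact false_of_seed44 hc hw hr0 hfloor hshade he haa hletters htilt hpass (m := k + 2) (by omega) hr2 h44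
  · -- every later state is `(2,1)` with the marker and the step is the pure corner
    have hind : ∀ n, (c (k + 2 + n)).r = Finsupp.single a 2 + Finsupp.single a' 1 ∧
        coeff (Finsupp.single a 4 + Finsupp.single a' 5) (c (k + 2 + n)).F ≠ 0 := by
      intro n
      induction n with
      | zero => exact ⟨hr2, h45⟩
      | succ n ih =>
        obtain ⟨-, hr', h'⟩ := corner_of_seed45 hc hw hr0 hfloor hshade he haa hletters htilt hpass
          (m := k + 2 + n) (by omega) ih.1 ih.2
        rw [show k + 2 + (n + 1) = k + 2 + n + 1 by omega]
        exact ⟨hr', h'⟩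
    obtain ⟨m, hm, i, hij, hbi, -⟩ := hlossy (k + 2)
    obtain ⟨n, rfl⟩ : ∃ n, m = k + 2 + n := ⟨m - (k + 2), by omega⟩
    obtain ⟨hb0, -, -⟩ := corner_of_seed45 hc hw hr0 hfloor hshade he haa hletters htilt hpass
      (m := k + 2 + n) (by omega) (hind n).1 (hind n).2
    exact hbi (by rw [hb0]; rfl)

/-- **NO LOSSY TILT-FREE D∞ TAIL AT `(p, d) = (5, 4)`** (HEADLINE of the tilt-free D∞ brick, slice C of K2(p),
idea-4 E2-WINDOW §D (D-TT) in the tree's frame).  Over a field of characteristic `5`: there is NO isolated above-floor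
witnessed `Step0 5` chain with `x^{r₀} ∣ F₀`, of constant shade `4` and `e_G = 2` from `k₀` on, chart letters in
`{a, a′}`, TILT-FREE (`e_a, e_{a′}` in every polar kernel), PASSIVE-FREE (the two inert letters never boundary), that
is LOSSY (translates a boundary letter beyond every index).  Proof: the first loss after `k₀` is a lose-both step in one
of the two orientations; `false_of_loseBoth`.  Riders: `p = 5 = d + 1` is used twice (Frobenius sextic row, legality
numerology); tilted D∞ tails and tails with a passive boundary letter (B∞) are NOT covered; nothing here proves K2(5).
[OURS] [cite: CossartJannsenSaito2020, Thm. 3.14, Lemma 13.2, Thm. 13.7] [cite: HauserPerlega2019PRIMS, §2 (transform D′ of D)] -/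
theorem no_lossy_tiltFree_pair_tail_four_five {c : ℕ → State K} {j : ℕ → Fin 4} {b : ℕ → Fin 4 → K}
    (hc : ∀ k, IsIsolated 5 (c k).F ∧ Step0 5 (c k) (c (k + 1))) (hw : FreeTail.IsWitnessedChain 5 c j b)
    (hr0 : ∀ e ∈ (c 0).F.support, (c 0).r ≤ e) (hfloor : ∀ k, ordZero (c k).F ≠ 5) {k₀ : ℕ}
    (hshade : ∀ k, k₀ ≤ k → (c k).shade = ((4 : ℕ) : ℕ∞))
    (he : ∀ k, k₀ ≤ k → Module.finrank K (resVertex (c k)) = 2) {a a' : Fin 4} (haa : a ≠ a')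
    (hletters : ∀ k, k₀ ≤ k → (j k = a ∨ j k = a'))
    (htilt : ∀ k, k₀ ≤ k → (Pi.single a 1 : Fin 4 → K) ∈ resVertex (c k) ∧
      (Pi.single a' 1 : Fin 4 → K) ∈ resVertex (c k))
    (hpass : ∀ k, k₀ ≤ k → ∀ i, i ≠ a → i ≠ a' → (c k).r i = 0)
    (hlossy : ∀ N, ∃ k, N ≤ k ∧ ∃ i, i ≠ j k ∧ b k i ≠ 0 ∧ 1 ≤ (c k).r i) : False := by
  obtain ⟨k, hk, i, hij, hbi, hri⟩ := hlossy k₀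
  have hi : i = a ∨ i = a' := by
    by_contra h
    push Not at h
    have := hpass k hk i h.1 h.2
    omega
  rcases hi with rfl | rfl
  · -- the translated boundary letter is `a`: the chart is `a′`, a lose-both `(a′, a)`
    have hja' : j k = a' := by
      rcases hletters k hk with h | h
      · exact absurd h.symm hij
      · exact h
    exact false_of_loseBoth hc hw hr0 hfloor hshade he haa.symm (fun k hk => (hletters k hk).symm)
      (fun k hk => ⟨(htilt k hk).2, (htilt k hk).1⟩) (fun k hk i h1 h2 => hpass k hk i h2 h1) hlossy hk hja' hbi
  · have hja : j k = a := by
      rcases hletters k hk with h | h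
      · exact h
      · exact absurd h.symm hij
    exact false_of_loseBoth hc hw hr0 hfloor hshade he haa hletters htilt hpass hlossy hk hja hbi

/-- **NO TILT-FREE D∞ TAIL AT `(p, d) = (5, 4)` — the outright form.**  Over a field of characteristic `5` there is NO
isolated above-floor witnessed `Step0 5` chain with `x^{r₀} ∣ F₀`, of constant shade `4` and `e_G = 2` from `k₀` on,
whose polar kernels all contain `e_a` and `e_{a′}` (TILT-FREE along the pair `{a, a′}`) and whose two other letters
never carry boundary (PASSIVE-FREE).  The chart letters lie in `{a, a′}` by `chain_letters_of_tiltFree`; an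
eventually loss-free tail is excluded by `…LossFreeTail.no_lossfree_tail` (res-dim4-p-5 g3), an infinitely lossy one by
`no_lossy_tiltFree_pair_tail_four_five`.  Riders as there; K2(5) stays OPEN. [OURS]
[cite: CossartJannsenSaito2020, Thm. 3.14, Lemma 13.2, Thm. 13.7] [cite: HauserPerlega2019PRIMS, §2 (transform D′ of D)] -/
theorem no_tiltFree_pair_tail_four_five {c : ℕ → State K} {j : ℕ → Fin 4} {b : ℕ → Fin 4 → K}
    (hc : ∀ k, IsIsolated 5 (c k).F ∧ Step0 5 (c k) (c (k + 1))) (hw : FreeTail.IsWitnessedChain 5 c j b)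
    (hr0 : ∀ e ∈ (c 0).F.support, (c 0).r ≤ e) (hfloor : ∀ k, ordZero (c k).F ≠ 5) {k₀ : ℕ}
    (hshade : ∀ k, k₀ ≤ k → (c k).shade = ((4 : ℕ) : ℕ∞))
    (he : ∀ k, k₀ ≤ k → Module.finrank K (resVertex (c k)) = 2) {a a' : Fin 4} (haa : a ≠ a')
    (htilt : ∀ k, k₀ ≤ k → (Pi.single a 1 : Fin 4 → K) ∈ resVertex (c k) ∧
      (Pi.single a' 1 : Fin 4 → K) ∈ resVertex (c k))
    (hpass : ∀ k, k₀ ≤ k → ∀ i, i ≠ a → i ≠ a' → (c k).r i = 0) : False := by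
  haveI : Fact (Nat.Prime 5) := ⟨by norm_num⟩
  have hletters : ∀ k, k₀ ≤ k → (j k = a ∨ j k = a') :=
    fun k hk => chain_letters_of_tiltFree hc hw hr0 hfloor hshade he haa htilt hk
  by_cases hlossy : ∀ N, ∃ k, N ≤ k ∧ ∃ i, i ≠ j k ∧ b k i ≠ 0 ∧ 1 ≤ (c k).r i
  · exact no_lossy_tiltFree_pair_tail_four_five hc hw hr0 hfloor hshade he haa hletters htilt hpass hlossy
  · push Not at hlossy
    obtain ⟨N, hN⟩ := hlossy
    refine no_lossfree_tail 5 hc hw hr0 hfloor (k₀ := max k₀ N) (d := 4) (by norm_num)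
      (fun k hk => hshade k (le_of_max_le_left hk)) (fun k hk => he k (le_of_max_le_left hk)) ?_
    intro k hk i hbi
    by_cases hij : i = j k
    · rw [hij] at hbi; exact absurd (hw k).2.1 hbi
    · have := hN k (le_of_max_le_right hk) i hij hbi
      omega

end EndGame

end ResCone

end Summit.ResolutionOfSingularities.ResolutionOfSingularities.Theorems.PIDim4

end
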